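import Literature.IUT.HodgeArakelov.SymmetryCombinatorics
import Literature.IUT.HodgeArakelov.BadPrimeGaussianMonoidsProofs2

/-!
# [IUTchII] Remark 3.5.2 (ii): inhabitation of the record `ConjugateSynchronizationPrinciple`

Mochizuki, *Inter-universal Teichmüller theory II*, §3, Remark 3.5.2 (ii), kurims manuscript (Dec. 2020)
p. 98 [claim: Mochizuki2012, status: disputed] (IUTchII §3 Rmk 3.5.2 (ii), kurims p.98): the "central
principle" of conjugate synchronization — "the `F_l^⋊±`-symmetry … allows one to construct (a) symmetrizing
isomorphisms … compatible with maintaining a (b) bijective link with the set of labels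
`LabCusp^±(Π_X(M^Θ_*))` … all relative to (c) a single basepoint". Record-only vocabulary under the claim key
`Mochizuki2012` (D-0012, disputed); abc-iut cell, layer L6, NON-VACUITY CERTIFICATE (abc-iut-L6-lead
§F v1.18p «NV-L6 WAVE», row `NV-L6/ConjugateSynchronizationPrinciple`; inhabitation census abc-iut-w5-d114 v3
§A: ZERO producers) for abc-iut-L6's record `Literature.IUT.HodgeArakelov.ConjugateSynchronizationPrinciple`
(`SymmetryCombinatorics.lean`): a structure with exactly three `Prop`-valued fields `symmetrizingIsos`,
`bijectiveLabelLink`, `singleBasepoint` (the three named requirements (a)–(c), recorded as SLOTS, not asserted).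

What the kernel says (this file; proof-only: no `def`, no instance, no named fact; nothing asserted about print):

* `ConjugateSynchronizationPrinciple.nonempty_iff_true` — EXACT INHABITATION CONDITION: the record is a triple of
  propositions, hence inhabited unconditionally (e.g. by three copies of `True`), and also by three copies of
  `False` (`exists_slots_all_false`): the record itself constrains nothing, so a theorem quantified over
  `R : ConjugateSynchronizationPrinciple` receives no mathematical input from `R` beyond what it assumes about
  the three slots. HONEST LABEL: slot record — trivially inhabited.
* `ConjugateSynchronizationPrinciple.exists_model` — the GENUINE-CONTENT instance: the three slots filled by
  the kernel statements of [IUTchII] Cor. 3.5 (i) over abc-iut-L6-t1's `𝔽^±_l`-torsor interface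
  `FlTorsorStructure C` (Def. 2.3 (v), `LabelClassesOfCusps.lean`), quantified over ALL bad-place settings,
  tempered-covering data, `±`-towers, cuspidal-inertia data and torsor structures `(S, P, T, W, C, F)`:
  (a) ↦ "symmetrizing isomorphisms exist between the data at any two labels" — transitivity of the conjugation
  action of `Π̂^cor_v` on `LabCusp^±(Π̂^±_v)`; (b) ↦ "bijective link with the set of labels" — the chart
  `LabCusp^±(Π̂^±_v) ≃ 𝔽_l` is a bijection; (c) ↦ "a single basepoint" — its LABEL-LEVEL kernel shadow:
  `Π̂^±_v` acts trivially on `LabCusp^±`, i.e. the symmetrizing isomorphisms are well defined up to an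
  indeterminacy that does not move labels (independent of the label). All three slots are then PROVED, BY NAME,
  from abc-iut-w4-d004's `BadPrimeGaussianMonoids.exists_conjAct_eq` / `conjAct_eq_self_of_mem_pmHat`
  (`BadPrimeGaussianMonoidsProofs2.lean`, p411833) and the chart's `Equiv.bijective`. READING NOTE: (c) in
  print concerns the pair `Π_{v▶} ↷ Ψ_cns` and a single inner-automorphism indeterminacy of `Π_X(M^Θ_*)`
  (Cor. 3.5 (i), p. 94); the tree carries only its label-level shadow (audit note of w4-d020 recorded in
  Proofs2), which is what slot (c) receives here — said openly. The instance is GENUINE in content (landed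
  theorems over the landed interfaces) but VACUOUSLY TRUE wherever those interfaces are themselves uninhabited
  (NV rows `PlusMinusTower`, `CuspidalInertiaData`, `FlTorsorStructure` of the same wave): universally
  quantified slots do not certify that a `(W, C, F)` exists.

Nothing here bears on [IUTchIII] Cor. 3.12; no side is taken; typed ≠ proved ≠ endorsed.
-/

namespace Literature.IUT.HodgeArakelov

universe u

namespace ConjugateSynchronizationPrinciple

open Literature.IUT.HodgeTheaters

/-- **IUTchII:Rmk3.5.2(ii)** (kurims p. 98) — EXACT INHABITATION CONDITION of the slot record: it is inhabited,
unconditionally (three `Prop` slots; witness `⟨True, True, True⟩` built inside the term). HONEST LABEL: slot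
record, trivially inhabited — this certifies nothing about (a)–(c). [claim: Mochizuki2012, status: disputed] (IUTchII §3 Rmk 3.5.2 (ii), kurims p.98) -/
theorem nonempty_iff_true : Nonempty ConjugateSynchronizationPrinciple ↔ True :=
  ⟨fun _ => trivial, fun _ => ⟨⟨True, True, True⟩⟩⟩

/-- **IUTchII:Rmk3.5.2(ii)** (kurims p. 98) — the record also admits the instance whose three slots are `False`:
the structure imposes NO relation between, or truth of, its slots (bookkeeping for consumers: any content must
come from hypotheses ON the slots, never from the record). [claim: Mochizuki2012, status: disputed] (IUTchII §3 Rmk 3.5.2 (ii), kurims p.98) -/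
theorem exists_slots_all_false :
    ∃ R : ConjugateSynchronizationPrinciple,
      ¬ R.symmetrizingIsos ∧ ¬ R.bijectiveLabelLink ∧ ¬ R.singleBasepoint :=
  ⟨⟨False, False, False⟩, id, id, id⟩

/-- **IUTchII:Rmk3.5.2(ii)** (kurims p. 98) with **Cor. 3.5 (i)** (p. 94) — the GENUINE-CONTENT instance: the
slots (a) symmetrizing isomorphisms, (b) bijective link with the labels, (c) single basepoint [label-level
shadow] are the kernel statements of Cor. 3.5 (i) over every `𝔽^±_l`-torsor structure `F` on the `±`-label
classes of cusps (Def. 2.3 (v)), and in this instance ALL THREE SLOTS HOLD — by abc-iut-w4-d004's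
`BadPrimeGaussianMonoids.exists_conjAct_eq` (transitivity of the conjugation action of `Π̂^cor_v` on
`LabCusp^±(Π̂^±_v)`), the chart `LabCusp^±(Π̂^±_v) ≃ 𝔽_l` being a bijection, and
`BadPrimeGaussianMonoids.conjAct_eq_self_of_mem_pmHat` (`Π̂^±_v` fixes every label). The witness is built
inside the term; no model of `(W, C, F)` is constructed here (see the NV rows of those interfaces).
[claim: Mochizuki2012, status: disputed] (IUTchII §3 Rmk 3.5.2 (ii), kurims p.98) -/
theorem exists_model :
    ∃ R : ConjugateSynchronizationPrinciple,
      (R.symmetrizingIsos ↔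
          ∀ (S : BadPlaceSetting.{u}) (P : TopGroup.{u}) (T : TemperedCoverings S P) (W : PlusMinusTower T)
            (C : CuspidalInertiaData W) (F : FlTorsorStructure C) (t t' : LabCuspPM C W.pmHat W.pmHat),
            ∃ g : W.Corhat, F.conjAct g t = t') ∧
        (R.bijectiveLabelLink ↔
          ∀ (S : BadPlaceSetting.{u}) (P : TopGroup.{u}) (T : TemperedCoverings S P) (W : PlusMinusTower T)
            (C : CuspidalInertiaData W) (F : FlTorsorStructure C), Function.Bijective F.chart) ∧
        (R.singleBasepoint ↔
          ∀ (S : BadPlaceSetting.{u}) (P : TopGroup.{u}) (T : TemperedCoverings S P) (W : PlusMinusTower T)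
            (C : CuspidalInertiaData W) (F : FlTorsorStructure C) (g : W.Corhat), g ∈ W.pmHat →
            ∀ t : LabCuspPM C W.pmHat W.pmHat, F.conjAct g t = t) ∧
        R.symmetrizingIsos ∧ R.bijectiveLabelLink ∧ R.singleBasepoint := by
  refine ⟨⟨∀ (S : BadPlaceSetting.{u}) (P : TopGroup.{u}) (T : TemperedCoverings S P) (W : PlusMinusTower T)
      (C : CuspidalInertiaData W) (F : FlTorsorStructure C) (t t' : LabCuspPM C W.pmHat W.pmHat),
      ∃ g : W.Corhat, F.conjAct g t = t',
    ∀ (S : BadPlaceSetting.{u}) (P : TopGroup.{u}) (T : TemperedCoverings S P) (W : PlusMinusTower T)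
      (C : CuspidalInertiaData W) (F : FlTorsorStructure C), Function.Bijective F.chart,
    ∀ (S : BadPlaceSetting.{u}) (P : TopGroup.{u}) (T : TemperedCoverings S P) (W : PlusMinusTower T)
      (C : CuspidalInertiaData W) (F : FlTorsorStructure C) (g : W.Corhat), g ∈ W.pmHat →
      ∀ t : LabCuspPM C W.pmHat W.pmHat, F.conjAct g t = t⟩,
    Iff.rfl, Iff.rfl, Iff.rfl, ?_, ?_, ?_⟩
  · exact fun S P T W C F t t' => BadPrimeGaussianMonoids.exists_conjAct_eq F t t'
  · exact fun S P T W C F => F.chart.bijective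
  · exact fun S P T W C F g hg t => BadPrimeGaussianMonoids.conjAct_eq_self_of_mem_pmHat F hg t

end ConjugateSynchronizationPrinciple

end Literature.IUT.HodgeArakelov
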